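import Mathlib
import Summits.NavierStokesRegularity.NavierStokesRegularity.Theorems.WakeRatchetTailRatchetEternalActionSummable
import Summits.NavierStokesRegularity.NavierStokesRegularity.Theorems.WakeRatchetTailRatchetDSSAmplitudeFloor
import HarnessLib

/-!
# `WakeRatchet.TailRatchet` (stmt-NavierStokesRegularity-21808): the GAP THEOREM — a bounded admissible
# inviscid eternal solution of the renormalised lattice is either trivial or has renormalised amplitude
# `≥ 1/((Λ + Λ⁻¹)·fluxConst α)` (on `E₂(R)` tables with `ε₀ ≤ 1`: `> 1/576`)

Support file for the crux `TailRatchet` (route `WakeRatchet`; MODEL lattice ODEs of Tao 2016 §4 —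
nothing in this file is a statement about the Navier–Stokes equations, and no item is closed here).

The crux (and its rate form stmt-25584 / inviscid slice stmt-25646) quantifies over uniformly bounded
admissible eternal solutions `W` (`IsEternal ε₀ α W`, `‖W_n(σ)‖ ≤ C`).  From the shell balance
`∫‖W_n‖² = Λ·I_{n−1} − Λ⁻¹·I_n` and `|I_k| ≤ fluxConst α·C·∫‖W_k‖²` of the companion file
`WakeRatchetTailRatchetEternalActionSummable` one gets the one-step recursion
`(1 − Λ⁻¹ f C)·∫‖W_n‖² ≤ Λ f C·∫‖W_{n−1}‖²` (`f = fluxConst α`); when `(Λ + Λ⁻¹)·f·C < 1` its ratio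
is `< 1`, and since the shell actions are uniformly bounded (`∫‖W_n‖² ≤ C·M`, admissibility), iterating
down the lattice from `n − k → n` and letting `k → ∞` gives `∫‖W_n‖² = 0` for every shell:

* `integral_norm_sq_le_action` — `∫‖W_n‖² ≤ C·M`;
* `action_sq_step` — the one-step recursion;
* `eq_zero_of_small_bound` — **GAP / ε-REGULARITY**: `(Λ + Λ⁻¹)·fluxConst α·C < 1 ⇒ W ≡ 0`;
* `one_le_of_ne_zero` — contrapositive: a non-trivial bounded admissible inviscid eternal solution has
  `(Λ + Λ⁻¹)·fluxConst α·C ≥ 1` for every uniform bound `C`;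
* `bigLam_add_inv_lt_nine`, `gap_comparable` — on a cancelling `R`-comparable table (`m = 4`,
  `fluxConst ≤ 64`) with `0 ≤ ε₀ ≤ 1`: every uniform bound of a non-trivial solution exceeds `1/576`.

READING FOR THE CENSUS of stmt-21808 / 25646 / 20420: the hypothesis class «uniformly bounded
admissible inviscid eternal solution» has a UNIVERSAL AMPLITUDE GAP — renormalised limits of blow-up
(K2-type extractions) are either trivial or of type-I size `> 1/576`, and no witness against the
ratchets can be a small perturbation of `W = 0`.  Compare the DSS-specific floor `1/(896 ε₀)`
(`WakeRatchetTailRatchetDSSAmplitudeFloor`), which diverges as `ε₀ → 0`; the gap here is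
`ε₀`-uniform and needs no self-similarity.  The viscous case (`ν̂ > 0`, where the dissipation only
helps the recursion) is not treated here (the full-line integrability of the covariant dissipation term
is the missing bookkeeping).

HONEST FRAMING: elementary real analysis on the cell's lemma layer; MODEL lattice only.
-/

noncomputable section

set_option linter.dupNamespace false

namespace Summit.NavierStokesRegularity.NavierStokesRegularity.Theorems

namespace WakeRatchetEternalGap

open MeasureTheory Set Filter Topology
open scoped RealInnerProductSpace
open Literature.Analysis.FluidPDE Literature.Analysis.FluidPDE.TaoCascade
open WakeRatchetEternalActionSummable

variable {m : ℕ} {ε₀ : ℝ} {α : Fin m → Fin m → Fin m → ℤ × ℤ × ℤ → ℝ} {W : ℤ → ℝ → Em m}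

/-- Shell actions are uniformly bounded: `∫‖W_n‖² ≤ C·M` (`M` an admissible action bound).
[cite: Tao2016AveragedNS, §4 Lemma 4.1 (4.8) (admissibility clauses are the cell's); cell lemma] -/
theorem integral_norm_sq_le_action (hW : IsEternal ε₀ α W) {C : ℝ} (hC : ∀ k σ, ‖W k σ‖ ≤ C)
    {M : ℝ} (hM : ∀ n : ℤ, Integrable (fun σ => ‖W n σ‖) ∧ ∫ σ, ‖W n σ‖ ≤ M) (n : ℤ) :
    ∫ σ, ‖W n σ‖ ^ 2 ≤ C * M := by
  have hC0 : 0 ≤ C := (norm_nonneg _).trans (hC 0 0)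
  calc ∫ σ, ‖W n σ‖ ^ 2 ≤ ∫ σ, C * ‖W n σ‖ := by
        refine integral_mono (integrable_norm_sq hW hC n) ((hM n).1.const_mul C) fun σ => ?_
        simp only [sq]
        exact mul_le_mul_of_nonneg_right (hC n σ) (norm_nonneg _)
    _ = C * ∫ σ, ‖W n σ‖ := integral_const_mul _ _
    _ ≤ C * M := mul_le_mul_of_nonneg_left (hM n).2 hC0

/-- **One-step recursion of shell actions**: `(1 − Λ⁻¹ f C)·∫‖W_n‖² ≤ Λ f C·∫‖W_{n−1}‖²`
(`f = fluxConst α`), from the shell balance and the flux bounds.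
[cite: Tao2016AveragedNS, §4 (4.1)–(4.3), Lemma 4.1 (4.9)–(4.10), §6.4; cell theorem] -/
theorem action_sq_step (hW : IsEternal ε₀ α W) (hc : IsCancellingCoeff α) {C : ℝ}
    (hC : ∀ k σ, ‖W k σ‖ ≤ C) (hΛ : 0 ≤ bigLam ε₀) (n : ℤ) :
    (1 - (bigLam ε₀)⁻¹ * fluxConst α * C) * ∫ σ, ‖W n σ‖ ^ 2
      ≤ bigLam ε₀ * fluxConst α * C * ∫ σ, ‖W (n - 1) σ‖ ^ 2 := by
  have hbal := integral_norm_sq_eq hW hc hC n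
  have h1 : |∫ σ, ⟪W n σ, tableA α (W (n - 1) σ)⟫| ≤ fluxConst α * C * ∫ σ, ‖W (n - 1) σ‖ ^ 2 := by
    have h := abs_integral_flux_le hW hc hC (n - 1)
    simp only [sub_add_cancel] at h
    exact h
  have h2 := abs_integral_flux_le hW hc hC n
  have hb1 : bigLam ε₀ * ∫ σ, ⟪W n σ, tableA α (W (n - 1) σ)⟫
      ≤ bigLam ε₀ * (fluxConst α * C * ∫ σ, ‖W (n - 1) σ‖ ^ 2) :=
    mul_le_mul_of_nonneg_left ((le_abs_self _).trans h1) hΛ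
  have hb2 : -((bigLam ε₀)⁻¹ * ∫ σ, ⟪W (n + 1) σ, tableA α (W n σ)⟫)
      ≤ (bigLam ε₀)⁻¹ * (fluxConst α * C * ∫ σ, ‖W n σ‖ ^ 2) := by
    rw [← mul_neg]
    exact mul_le_mul_of_nonneg_left ((neg_le_abs _).trans h2) (inv_nonneg.2 hΛ)
  have key : ∫ σ, ‖W n σ‖ ^ 2 ≤ bigLam ε₀ * (fluxConst α * C * ∫ σ, ‖W (n - 1) σ‖ ^ 2)
      + (bigLam ε₀)⁻¹ * (fluxConst α * C * ∫ σ, ‖W n σ‖ ^ 2) := by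
    calc ∫ σ, ‖W n σ‖ ^ 2 = bigLam ε₀ * (∫ σ, ⟪W n σ, tableA α (W (n - 1) σ)⟫)
          - (bigLam ε₀)⁻¹ * ∫ σ, ⟪W (n + 1) σ, tableA α (W n σ)⟫ := hbal
      _ ≤ bigLam ε₀ * (fluxConst α * C * ∫ σ, ‖W (n - 1) σ‖ ^ 2)
          + (bigLam ε₀)⁻¹ * (fluxConst α * C * ∫ σ, ‖W n σ‖ ^ 2) := by linarith
  have e : (1 - (bigLam ε₀)⁻¹ * fluxConst α * C) * ∫ σ, ‖W n σ‖ ^ 2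
      = (∫ σ, ‖W n σ‖ ^ 2) - (bigLam ε₀)⁻¹ * (fluxConst α * C * ∫ σ, ‖W n σ‖ ^ 2) := by ring
  rw [e]
  linarith

/-- **Gap theorem (ε-regularity for eternal solutions).**  A uniformly bounded admissible INVISCID
eternal solution of a cancelling table at scale ratio `1+ε₀` (`0 ≤ ε₀`) whose uniform bound `C`
satisfies `(Λ + Λ⁻¹)·fluxConst α·C < 1` vanishes identically: the recursion `action_sq_step` has ratio
`q = Λ f C/(1 − Λ⁻¹ f C) < 1`, the shell actions are bounded by `C·M`, so `∫‖W_n‖² ≤ q^k·C·M` for every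
`k`, i.e. `∫‖W_n‖² = 0`.
[cite: Tao2016AveragedNS, §4 (4.1)–(4.3), Lemma 4.1 (4.8)–(4.10), §6.4; cell theorem] -/
theorem eq_zero_of_small_bound (hε : 0 ≤ ε₀) (hW : IsEternal ε₀ α W) (hc : IsCancellingCoeff α)
    {C : ℝ} (hC : ∀ k σ, ‖W k σ‖ ≤ C)
    (hsmall : (bigLam ε₀ + (bigLam ε₀)⁻¹) * fluxConst α * C < 1) :
    ∀ (n : ℤ) (σ : ℝ), W n σ = 0 := by
  obtain ⟨M, hM⟩ := hW.action
  have hΛ1 : 1 ≤ bigLam ε₀ := one_le_bigLam hε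
  have hΛ0 : 0 < bigLam ε₀ := by linarith
  have hf0 : 0 ≤ fluxConst α := (table_sTable α hc).CA_nonneg
  have hC0 : 0 ≤ C := (norm_nonneg _).trans (hC 0 0)
  have hfC : 0 ≤ fluxConst α * C := mul_nonneg hf0 hC0
  set J : ℤ → ℝ := fun n => ∫ σ, ‖W n σ‖ ^ 2 with hJ
  have hJ0 : ∀ n, 0 ≤ J n := fun n => integral_nonneg fun σ => by positivity
  have hJB : ∀ n, J n ≤ C * M := fun n => integral_norm_sq_le_action hW hC hM n
  -- the recursion with ratio `q < 1`
  set a : ℝ := (bigLam ε₀)⁻¹ * fluxConst α * C with ha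
  set b : ℝ := bigLam ε₀ * fluxConst α * C with hb
  have hab : a + b < 1 := by rw [ha, hb]; linarith
  have ha0 : 0 ≤ a := by rw [ha]; positivity
  have hb0 : 0 ≤ b := by rw [hb]; positivity
  have h1a : 0 < 1 - a := by linarith
  set q : ℝ := b / (1 - a) with hq
  have hq0 : 0 ≤ q := div_nonneg hb0 h1a.le
  have hq1 : q < 1 := by rw [hq, div_lt_one h1a]; linarith
  have hstep : ∀ n : ℤ, J n ≤ q * J (n - 1) := by
    intro n
    have h := action_sq_step hW hc hC hΛ0.le n
    rw [hq, div_mul_eq_mul_div, le_div_iff₀ h1a]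
    simp only [hJ]
    linarith
  -- iterate: `J n ≤ q^k · (C·M)` for every `k`
  have hiter : ∀ (k : ℕ) (n : ℤ), J n ≤ q ^ k * (C * M) := by
    intro k
    induction k with
    | zero => intro n; simpa using hJB n
    | succ k ih =>
      intro n
      calc J n ≤ q * J (n - 1) := hstep n
        _ ≤ q * (q ^ k * (C * M)) := mul_le_mul_of_nonneg_left (ih (n - 1)) hq0
        _ = q ^ (k + 1) * (C * M) := by ring
  have hJzero : ∀ n, J n = 0 := by
    intro n
    refine le_antisymm ?_ (hJ0 n)
    have hlim : Tendsto (fun k : ℕ => q ^ k * (C * M)) atTop (𝓝 (0 * (C * M))) :=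
      (tendsto_pow_atTop_nhds_zero_of_lt_one hq0 hq1).mul_const _
    rw [zero_mul] at hlim
    exact ge_of_tendsto' hlim fun k => hiter k n
  -- a continuous non-negative function with zero integral vanishes
  intro n σ
  have hE := integrable_norm_sq hW hC n
  have hae : (fun σ => ‖W n σ‖ ^ 2) =ᵐ[volume] 0 :=
    (integral_eq_zero_iff_of_nonneg (fun σ => by positivity) hE).1 (hJzero n)
  have hcont : Continuous (fun σ => ‖W n σ‖ ^ 2) := ((continuous_shell hW n).norm).pow 2
  have hzero := congrFun ((Continuous.ae_eq_iff_eq volume hcont continuous_const).1 hae) σ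
  have h0 : ‖W n σ‖ ^ 2 = 0 := hzero
  exact norm_eq_zero.1 ((pow_eq_zero_iff two_ne_zero).1 h0)

/-- **Amplitude gap, contrapositive form.**  A NON-TRIVIAL uniformly bounded admissible inviscid
eternal solution of a cancelling table has `(Λ + Λ⁻¹)·fluxConst α·C ≥ 1` for every uniform bound `C`
of its shells. [cite: Tao2016AveragedNS, §4 (4.1)–(4.3), Lemma 4.1 (4.8)–(4.10), §6.4; cell theorem] -/
theorem one_le_of_ne_zero (hε : 0 ≤ ε₀) (hW : IsEternal ε₀ α W) (hc : IsCancellingCoeff α)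
    {C : ℝ} (hC : ∀ k σ, ‖W k σ‖ ≤ C) (hne : ∃ n σ, W n σ ≠ 0) :
    1 ≤ (bigLam ε₀ + (bigLam ε₀)⁻¹) * fluxConst α * C := by
  by_contra h
  push Not at h
  obtain ⟨n, σ, hnz⟩ := hne
  exact hnz (eq_zero_of_small_bound hε hW hc hC h n σ)

/-! ## Comparable tables with `ε₀ ≤ 1`: the gap is `1/576` -/

/-- `Λ + Λ⁻¹ < 9` for `0 ≤ ε₀ ≤ 1` (`Λ = (1+ε₀)^{5/2} ≤ (1+ε₀)³ ≤ 8`, `Λ⁻¹ ≤ 1`; strict because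
`Λ⁻¹ < 1` or `Λ = 1`). [cite: Tao2016AveragedNS, §4 (4.1); elementary] -/
theorem bigLam_add_inv_lt_nine (hε : 0 ≤ ε₀) (hε1 : ε₀ ≤ 1) :
    bigLam ε₀ + (bigLam ε₀)⁻¹ < 9 := by
  have hb : 1 ≤ 1 + ε₀ := by linarith
  have hΛ1 : 1 ≤ bigLam ε₀ := one_le_bigLam hε
  have hle : bigLam ε₀ ≤ (1 + ε₀) ^ (3 : ℕ) := by
    unfold bigLam
    rw [← Real.rpow_natCast]
    exact Real.rpow_le_rpow_of_exponent_le hb (by norm_num)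
  have hcube : (1 + ε₀) ^ (3 : ℕ) ≤ 8 := by
    have h := pow_le_pow_left₀ (by linarith : (0 : ℝ) ≤ 1 + ε₀) (by linarith : 1 + ε₀ ≤ 2) 3
    norm_num at h
    exact h
  have hinv : (bigLam ε₀)⁻¹ ≤ 1 := inv_le_one_of_one_le₀ hΛ1
  rcases hΛ1.lt_or_eq with hgt | heq
  · have : (bigLam ε₀)⁻¹ < 1 := inv_lt_one_of_one_lt₀ hgt
    linarith
  · rw [← heq]; norm_num

/-- **The gap on comparable tables.**  On a cancelling `R`-comparable table (`m = 4`) at scale ratio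
`1+ε₀`, `0 ≤ ε₀ ≤ 1`, every uniform bound `C` of a non-trivial admissible inviscid eternal solution
satisfies `C > 1/576` — an `ε₀`-UNIFORM floor for the whole hypothesis class of the tail ratchets.
[cite: Tao2016AveragedNS, §4 (4.1)–(4.3), §6.1, §6.4; cell theorem] -/
theorem gap_comparable {ε₀ R : ℝ} {α : Fin 4 → Fin 4 → Fin 4 → ℤ × ℤ × ℤ → ℝ} {W : ℤ → ℝ → Em 4}
    (hε : 0 ≤ ε₀) (hε1 : ε₀ ≤ 1) (hc : IsCancellingCoeff α) (hα : IsComparableCoeff R α)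
    (hW : IsEternal ε₀ α W) {C : ℝ} (hC : ∀ k σ, ‖W k σ‖ ≤ C) (hne : ∃ n σ, W n σ ≠ 0) :
    1 / 576 < C := by
  have h1 := one_le_of_ne_zero hε hW hc hC hne
  have h9 := bigLam_add_inv_lt_nine hε hε1
  have h64 := WakeRatchetDSSAmplitudeFloor.fluxConst_le_64 hα
  have hf0 : 0 ≤ fluxConst α := (table_sTable α hc).CA_nonneg
  have hC0 : 0 ≤ C := (norm_nonneg _).trans (hC 0 0)
  rcases (mul_nonneg hf0 hC0).lt_or_eq with hpos | hzero
  · have h2 : (bigLam ε₀ + (bigLam ε₀)⁻¹) * fluxConst α * C < 9 * (fluxConst α * C) := by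
      rw [mul_assoc]; exact mul_lt_mul_of_pos_right h9 hpos
    have h3 : 9 * (fluxConst α * C) ≤ 9 * (64 * C) :=
      mul_le_mul_of_nonneg_left (mul_le_mul_of_nonneg_right h64 hC0) (by norm_num)
    rw [div_lt_iff₀ (by norm_num : (0 : ℝ) < 576)]
    linarith
  · exfalso
    rw [mul_assoc, ← hzero, mul_zero] at h1
    linarith

end WakeRatchetEternalGap

end Summit.NavierStokesRegularity.NavierStokesRegularity.Theorems

end
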